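import Summits.HodgeConjecture.CorCM.Census.CoverClosureMeta

/-!
# The square-central class, II: the residual lattice of a four-type base block — star defects, and its closure from FIVE kinds of relations

COR-CM (cell `pub-hodgecm2`), count-neutral kernel combinatorics by the binder seat b09 (gen 45; lane SQUARE-CENTRAL CLASS, part II), on top of part 0
(`Census/CoverClosureMeta.lean`), gen 32ʼs star normal form `thetaG` (`TwistGeneration.thetaG_typeSum_single`) and the intrinsic currency of
`CorCM/Prior/AllgGroup1.lean` (`typeSum`, `oflipCM`, `dev_oflip`), all BY NAME.  Theorems only: no definition, no `decide`, no certificate, no named fact,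
no `sorry`.  HONEST FRAMING: `HC_CM` is NOT proved, here or anywhere in the tree; nothing here is a period or a headline.

THE SETTING.  `G` finite, `c` a central involution `≠ 1`, `T₀` a base type and `θ = thetaG T₀` gen 32ʼs star section of the type sum
(`θ(typeSum [Φ]) = Σ_{t ∈ T₀∖Φ} ([T₀^{(t)}] − [T₀]) + [T₀]`).  The STAR DEFECT of a type `X` is `ρ(X) = [X] − θ(typeSum [X])` — a Hodge vector supported on
`X`, `T₀` and the single flips of `T₀`; `ρ(T₀) = ρ(T₀^{(s)}) = 0`.

* §1 **DEFECT CLOSURE** (model-free, `two_pow_smul_mem_of_defects`): if `L ⊇ ℤ⟨pairs⟩` contains `2^k ρ(X)` for every type `X` of a class `Res ∋ T₀, T̄₀`, then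
  `2^k y ∈ L` for every Hodge vector `y` supported on `Res` — the residual-closure hypothesis of part 0ʼs meta-theorem, with no coefficient extraction: for
  `y` of constant type sum `m`, `y − m·pair(T₀)` has type sum `0` and equals the sum of its defects.  Calculus: `ρ` of a flip (`defect_oflipCM_of_mem/_of_not_mem`:
  `ρ(X^{(s)}) = ρ(X) + ([X^{(s)}] − [X]) ∓ ([T₀^{(s)}] − [T₀])`) and of a complement (`defect_compl`: `ρ(X̄) = pair X − pair T₀ − ρ(X) + ρ(T̄₀)`).
* §2 **THE FOUR-TYPE BASE BLOCK.**  A second type `T₁`; `𝓗 = T₀ ∖ T₁` (the places where they differ) and `𝓗ᶜ = T₀ ∩ T₁`, both of size `2m`.  With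
  `e₀ = [T₀]`, `e₁ = [T₁]`, `f_s = [T₀^{(s)}]`, `g_s = [T₁^{(s)}]` the residual Hodge lattice is spanned (part III) by `Y_s = (f_s − e₀) + (g_s − e₁)` (`s ∈ 𝓗`),
  `Y'_s = (f_s − e₀) − (g_s − e₁)` (`s ∈ 𝓗ᶜ`) and two more classes; the relations a strict cover supplies are the TRANSVERSAL RELATIONS
  `R(T) = Σ_{s∈T} f_s − Σ_{u∈𝓗∖T} g_u − (m−1)(e₀ − e₁)` (`T ⊆ 𝓗`, `|T| = m`), `Rᶜ(T') = Σ_{s∈T'} f_s + Σ_{u∈𝓗ᶜ∖T'} g_u − (m−1)(e₀ + e₁)` (`T' ⊆ 𝓗ᶜ`, `|T'| = m`) and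
  the doubled classes `2Y_s`, `2Y'_s`.  THEOREM (`two_smul_defect_T₁_mem`, `…_compl_T₀_mem`, …): these put `2ρ(X)` in `L` for EVERY residual type `X` (the two
  base types, their complements, and all their single flips): `2ρ(T₁) = −2R(T) − Σ_{𝓗∖T} 2Y_t`, `ρ(T̄₀) = pair T₀ + ρ(T₁) + σ₁` with `2σ₁ = −2Rᶜ(T') − Σ_{𝓗ᶜ∖T'} 2Y'_t`,
  `ρ(T₁^{(s)}) = ρ(T₁) ± Y_s`, and §1 for flips and complements.
* §3 **RESIDUAL CLOSURE OF THE FOUR-TYPE BLOCK** (`residual_closure_four`): hence `2y ∈ L` for every Hodge vector `y` supported on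
  `{T₀, T̄₀, T₁, T̄₁}` and their single flips — the input of the strict cover-closure law (part I) for the rows `D₄ × E` of the lane, where part III shows that every
  strict lowering cover supplies exactly these five kinds of relations (numerics: index `2` or `4`, HOME/pub-hodgecm2-b09/lean-g45/CENTRAL-SQUARES.md).

## References
* [Pohlmann1968] H. Pohlmann, Algebraic cycles on abelian varieties of complex multiplication type, Ann. of Math. 88 (1968), Thm 1.
* [Milne1999] J. S. Milne, Lefschetz motives and the Tate conjecture, Compositio Math. 117 (1999), Prop. 2.1, p. 54.
-/

namespace Summit.HodgeConjecture.CorCM.Census.CentralSquares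

open Finset
open Summit.HodgeConjecture.CorCM.Prior.AllgGroup.RfwfAllgGroup
open Summit.HodgeConjecture.CorCM.Census.BlockParity
open Summit.HodgeConjecture.CorCM.Census.Coinvariant
open Summit.HodgeConjecture.CorCM.Census.TwistGeneration

noncomputable section

variable {G : Type*} [Group G] [Fintype G] [DecidableEq G] (c : G)

/-! ## §1 Star defects: closure, flips, complements -/

/-- **DEFECT CLOSURE.**  If `L ⊇ ℤ⟨pairs⟩` contains `2^k·([X] − θ_{T₀}(typeSum [X]))` for every type `X` of a class `Res` containing `T₀` and `T̄₀ = T₀·c`, then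
every Hodge vector supported on `Res` lies in `L` up to `2^k` (central `c ≠ 1`). [folklore] -/
theorem two_pow_smul_mem_of_defects (hc2 : c * c = 1) (hc1 : c ≠ 1) (hcen : ∀ x : G, x * c = c * x) (T₀ : CMF G c)
    (L : Submodule ℤ (CMF G c →₀ ℤ)) (hP : ∀ Ψ : CMF G c, pair c Ψ ∈ L) (Res : CMF G c → Prop) (hT₀ : Res T₀) (hT₀c : Res (rt c c T₀))
    (k : ℕ) (hρ : ∀ X : CMF G c, Res X →
      ((2 : ℤ) ^ k) • (Finsupp.single X 1 - thetaG c hc2 T₀ (typeSum G c (Finsupp.single X 1))) ∈ L) :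
    ∀ y ∈ hodgeSpan c hc2, (∀ Ψ ∈ y.support, Res Ψ) → ((2 : ℤ) ^ k) • y ∈ L := by
  classical
  intro y hy hyR
  obtain ⟨m, hm⟩ := (mem_hodgeSpan_iff c hc2 hc1 hcen y).mp hy
  set z : CMF G c →₀ ℤ := y - m • pair c T₀ with hz
  have hz0 : typeSum G c z = 0 := by
    funext x
    rw [hz, map_sub, map_smul, Pi.sub_apply, Pi.smul_apply, hm x, typeSum_pair c hcen, smul_eq_mul, mul_one, sub_self,
      Pi.zero_apply]
  have hzR : ∀ X ∈ z.support, Res X := by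
    intro X hX
    have h : X ∈ y.support ∪ (m • pair c T₀).support := Finsupp.support_sub hX
    rcases mem_union.mp h with h | h
    · exact hyR X h
    · have h' : X ∈ (pair c T₀).support := Finsupp.support_smul h
      rw [pair] at h'
      rcases mem_union.mp (Finsupp.support_add h') with h2 | h2
      · rw [((Finsupp.mem_support_single _ _ _).mp h2).1]; exact hT₀
      · rw [((Finsupp.mem_support_single _ _ _).mp h2).1]; exact hT₀c
  -- `z` is the sum of its defects, weighted by its coefficients
  set Θ : (CMF G c →₀ ℤ) →ₗ[ℤ] (CMF G c →₀ ℤ) := (thetaG c hc2 T₀).comp (typeSum G c) with hΘ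
  have hsum : z = ∑ X ∈ z.support, z X • (Finsupp.single X 1 - thetaG c hc2 T₀ (typeSum G c (Finsupp.single X 1))) := by
    have h1 : ∑ X ∈ z.support, z X • Finsupp.single X (1 : ℤ) = z := by
      conv_rhs => rw [← Finsupp.sum_single z]
      rw [Finsupp.sum]
      exact Finset.sum_congr rfl fun X _ => by rw [Finsupp.smul_single_one]
    have h2 : ∑ X ∈ z.support, z X • thetaG c hc2 T₀ (typeSum G c (Finsupp.single X 1)) = Θ z := by
      have e : ∀ X, thetaG c hc2 T₀ (typeSum G c (Finsupp.single X 1)) = Θ (Finsupp.single X 1) := fun X => rfl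
      simp_rw [e, ← map_zsmul, ← map_sum, h1]
    simp_rw [smul_sub]
    rw [Finset.sum_sub_distrib, h1, h2, hΘ, LinearMap.comp_apply, hz0, map_zero, sub_zero]
  have hzL : ((2 : ℤ) ^ k) • z ∈ L := by
    rw [hsum, Finset.smul_sum]
    refine Submodule.sum_mem _ fun X hX => ?_
    rw [smul_comm]
    exact Submodule.smul_mem _ _ (hρ X (hzR X hX))
  have e : ((2 : ℤ) ^ k) • y = ((2 : ℤ) ^ k) • z + ((2 : ℤ) ^ k) • (m • pair c T₀) := by rw [hz, smul_sub, sub_add_cancel]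
  rw [e]
  exact Submodule.add_mem _ hzL (Submodule.smul_mem _ _ (Submodule.smul_mem _ _ (hP T₀)))

/-- The base type has no defect: `[T₀] − θ(typeSum [T₀]) = 0`. [folklore] -/
theorem defect_base (hc2 : c * c = 1) (T₀ : CMF G c) :
    Finsupp.single T₀ 1 - thetaG c hc2 T₀ (typeSum G c (Finsupp.single T₀ 1)) = 0 := by
  rw [thetaG_typeSum_single c T₀ hc2, Finset.sdiff_self, sum_empty, zero_add, sub_self]

/-- **Defect of a flip at a deviation place** (`s ∈ T₀ ∖ X`, the flip moves toward `T₀`):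
`ρ(X^{(s)}) = ρ(X) + ([X^{(s)}] − [X]) + ([T₀^{(s)}] − [T₀])`. [folklore] -/
theorem defect_oflipCM_of_not_mem (hc2 : c * c = 1) (T₀ X : CMF G c) {s : G} (hsT : s ∈ T₀.1) (hsX : s ∉ X.1) :
    Finsupp.single (oflipCM c hc2 s X) 1 - thetaG c hc2 T₀ (typeSum G c (Finsupp.single (oflipCM c hc2 s X) 1)) =
      (Finsupp.single X 1 - thetaG c hc2 T₀ (typeSum G c (Finsupp.single X 1))) +
        (Finsupp.single (oflipCM c hc2 s X) 1 - Finsupp.single X 1) +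
        (Finsupp.single (oflipCM c hc2 s T₀) 1 - Finsupp.single T₀ 1) := by
  have hmem : s ∈ T₀.1 \ X.1 := mem_sdiff.mpr ⟨hsT, hsX⟩
  rw [thetaG_typeSum_single c T₀ hc2, thetaG_typeSum_single c T₀ hc2, dev_oflip c hc2 hsT hsX, ← Finset.add_sum_erase _ _ hmem]
  abel

/-- **Defect of a flip at an agreement place** (`s ∈ T₀ ∩ X`, the flip moves away from `T₀`):
`ρ(X^{(s)}) = ρ(X) + ([X^{(s)}] − [X]) − ([T₀^{(s)}] − [T₀])`. [folklore] -/
theorem defect_oflipCM_of_mem (hc2 : c * c = 1) (T₀ X : CMF G c) {s : G} (hsT : s ∈ T₀.1) (hsX : s ∈ X.1) :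
    Finsupp.single (oflipCM c hc2 s X) 1 - thetaG c hc2 T₀ (typeSum G c (Finsupp.single (oflipCM c hc2 s X) 1)) =
      (Finsupp.single X 1 - thetaG c hc2 T₀ (typeSum G c (Finsupp.single X 1))) +
        (Finsupp.single (oflipCM c hc2 s X) 1 - Finsupp.single X 1) -
        (Finsupp.single (oflipCM c hc2 s T₀) 1 - Finsupp.single T₀ 1) := by
  have hnot : s ∉ T₀.1 \ X.1 := fun h => (mem_sdiff.mp h).2 hsX
  rw [thetaG_typeSum_single c T₀ hc2, thetaG_typeSum_single c T₀ hc2, dev_oflip_of_mem c hc2 hsT hsX, Finset.sum_insert hnot]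
  abel

/-- The single flips of the base type have no defect. [folklore] -/
theorem defect_oflipCM_base (hc2 : c * c = 1) (T₀ : CMF G c) {s : G} (hsT : s ∈ T₀.1) :
    Finsupp.single (oflipCM c hc2 s T₀) 1 - thetaG c hc2 T₀ (typeSum G c (Finsupp.single (oflipCM c hc2 s T₀) 1)) = 0 := by
  rw [defect_oflipCM_of_mem c hc2 T₀ T₀ hsT hsT, defect_base, zero_add, sub_self]

/-- The deviation set of a complement: `T₀ ∖ X̄ = T₀ ∩ X = T₀ ∖ (T₀ ∖ X)` (central `c`). [folklore] -/
theorem dev_compl (hcen : ∀ x : G, x * c = c * x) (T₀ X : CMF G c) : T₀.1 \ (rt c c X).1 = T₀.1 \ (T₀.1 \ X.1) := by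
  rw [rt_self_val c hcen, sdiff_sdiff_right_self, Finset.inf_eq_inter]
  ext t
  simp only [mem_sdiff, mem_univ, true_and, not_not, mem_inter]

/-- **Defect of a complement**: `ρ(X̄) = pair X − pair T₀ − ρ(X) + ρ(T̄₀)` (central `c`). [folklore] -/
theorem defect_compl (hc2 : c * c = 1) (hcen : ∀ x : G, x * c = c * x) (T₀ X : CMF G c) :
    Finsupp.single (rt c c X) 1 - thetaG c hc2 T₀ (typeSum G c (Finsupp.single (rt c c X) 1)) =
      pair c X - pair c T₀ - (Finsupp.single X 1 - thetaG c hc2 T₀ (typeSum G c (Finsupp.single X 1))) +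
        (Finsupp.single (rt c c T₀) 1 - thetaG c hc2 T₀ (typeSum G c (Finsupp.single (rt c c T₀) 1))) := by
  have hsplit : ∑ t ∈ T₀.1 \ (T₀.1 \ X.1), (Finsupp.single (oflipCM c hc2 t T₀) (1 : ℤ) - Finsupp.single T₀ 1) =
      ∑ t ∈ T₀.1, (Finsupp.single (oflipCM c hc2 t T₀) (1 : ℤ) - Finsupp.single T₀ 1) -
        ∑ t ∈ T₀.1 \ X.1, (Finsupp.single (oflipCM c hc2 t T₀) (1 : ℤ) - Finsupp.single T₀ 1) := by
    rw [eq_sub_iff_add_eq, Finset.sum_sdiff (sdiff_subset : T₀.1 \ X.1 ⊆ T₀.1)]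
  have hT : T₀.1 \ (rt c c T₀).1 = T₀.1 := by rw [dev_compl c hcen, Finset.sdiff_self, Finset.sdiff_empty]
  rw [thetaG_typeSum_single c T₀ hc2, thetaG_typeSum_single c T₀ hc2, thetaG_typeSum_single c T₀ hc2, dev_compl c hcen T₀ X, hsplit, hT, pair, pair]
  abel

/-- Flips commute with complements (central `c`): `(X̄)^{(s)} = (X^{(s)})·c`. [folklore] -/
theorem oflipCM_rt_self (hc2 : c * c = 1) (hcen : ∀ x : G, x * c = c * x) (s : G) (X : CMF G c) :
    oflipCM c hc2 s (rt c c X) = rt c c (oflipCM c hc2 s X) := by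
  have hinv : c⁻¹ = c := inv_eq_of_mul_eq_one_right hc2
  rw [rt_oflipCM, hinv, hcen s, oflipCM_cmul]

/-! ## §2 The four-type base block: defects from transversal relations -/

section Four

variable (hc2 : c * c = 1) (T₀ T₁ : CMF G c)

/-- **`2ρ(T₁) ∈ L`** from one transversal relation `R(T)` on `𝓗 = T₀ ∖ T₁` and the doubled classes `2Y_t` (`t ∈ 𝓗 ∖ T`):
`2ρ(T₁) = −2R(T) − Σ_{t ∈ 𝓗∖T} 2Y_t` when `|𝓗| = 2m`, `|T| = m`. [folklore] -/
theorem two_smul_defect_T₁_mem (L : Submodule ℤ (CMF G c →₀ ℤ)) (m : ℕ) (hH : (T₀.1 \ T₁.1).card = 2 * m)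
    {T : Finset G} (hT : T ⊆ T₀.1 \ T₁.1) (hTm : T.card = m)
    (hR : ∑ s ∈ T, Finsupp.single (oflipCM c hc2 s T₀) (1 : ℤ) - ∑ u ∈ (T₀.1 \ T₁.1) \ T, Finsupp.single (oflipCM c hc2 u T₁) (1 : ℤ) -
      ((m : ℤ) - 1) • (Finsupp.single T₀ (1 : ℤ) - Finsupp.single T₁ 1) ∈ L)
    (h2Y : ∀ t ∈ (T₀.1 \ T₁.1) \ T, (2 : ℤ) • ((Finsupp.single (oflipCM c hc2 t T₀) (1 : ℤ) - Finsupp.single T₀ 1) +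
      (Finsupp.single (oflipCM c hc2 t T₁) (1 : ℤ) - Finsupp.single T₁ 1)) ∈ L) :
    (2 : ℤ) • (Finsupp.single T₁ 1 - thetaG c hc2 T₀ (typeSum G c (Finsupp.single T₁ 1))) ∈ L := by
  set e₀ : CMF G c →₀ ℤ := Finsupp.single T₀ 1 with he₀
  set e₁ : CMF G c →₀ ℤ := Finsupp.single T₁ 1 with he₁
  set f : G → (CMF G c →₀ ℤ) := fun s => Finsupp.single (oflipCM c hc2 s T₀) 1 with hf
  set g : G → (CMF G c →₀ ℤ) := fun s => Finsupp.single (oflipCM c hc2 s T₁) 1 with hg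
  have hcardD : (((T₀.1 \ T₁.1) \ T).card : ℤ) = m := by
    have h : ((T₀.1 \ T₁.1) \ T).card = m := by rw [card_sdiff_of_subset hT, hH, hTm]; omega
    exact_mod_cast h
  have hsumf : ∑ t ∈ T₀.1 \ T₁.1, f t = ∑ t ∈ (T₀.1 \ T₁.1) \ T, f t + ∑ t ∈ T, f t := (Finset.sum_sdiff hT).symm
  -- the identity `2ρ(T₁) = −2R − Σ 2Y`
  have key : (2 : ℤ) • (e₁ - ((∑ t ∈ T₀.1 \ T₁.1, (f t - e₀)) + e₀)) =
      -((2 : ℤ) • (∑ s ∈ T, f s - ∑ u ∈ (T₀.1 \ T₁.1) \ T, g u - ((m : ℤ) - 1) • (e₀ - e₁))) -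
        ∑ t ∈ (T₀.1 \ T₁.1) \ T, (2 : ℤ) • ((f t - e₀) + (g t - e₁)) := by
    rw [Finset.sum_sub_distrib, Finset.sum_const, hH, hsumf]
    rw [show ∑ t ∈ (T₀.1 \ T₁.1) \ T, (2 : ℤ) • ((f t - e₀) + (g t - e₁)) =
        (2 : ℤ) • (∑ t ∈ (T₀.1 \ T₁.1) \ T, f t) + (2 : ℤ) • (∑ t ∈ (T₀.1 \ T₁.1) \ T, g t) -
          (2 * (m : ℤ)) • e₀ - (2 * (m : ℤ)) • e₁ from by
      rw [← Finset.smul_sum, Finset.sum_add_distrib, Finset.sum_sub_distrib, Finset.sum_sub_distrib, Finset.sum_const,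
        Finset.sum_const, smul_add, smul_sub, smul_sub]
      rw [← Nat.cast_smul_eq_nsmul ℤ, ← Nat.cast_smul_eq_nsmul ℤ, hcardD, smul_smul, smul_smul]
      module]
    rw [← Nat.cast_smul_eq_nsmul ℤ (2 * m)]
    push_cast
    module
  have h := Submodule.sub_mem _ (Submodule.neg_mem _ (Submodule.smul_mem _ (2 : ℤ) hR)) (Submodule.sum_mem _ fun t ht => h2Y t ht)
  rw [thetaG_typeSum_single c T₀ hc2]
  rw [← key] at h
  exact h

/-- **The `𝓗ᶜ`-class `σ₁ = −e₁ − e₀ − Σ_{t ∈ 𝓗ᶜ} (f_t − e₀)` is in `L` up to `2`**: `2σ₁ = −2Rᶜ(T') − Σ_{t ∈ 𝓗ᶜ∖T'} 2Y'_t` (`|𝓗ᶜ| = 2m`, `|T'| = m`). [folklore] -/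
theorem two_smul_sigma_mem (L : Submodule ℤ (CMF G c →₀ ℤ)) (m : ℕ) (hHc : (T₀.1 ∩ T₁.1).card = 2 * m)
    {T' : Finset G} (hT' : T' ⊆ T₀.1 ∩ T₁.1) (hT'm : T'.card = m)
    (hRc : ∑ s ∈ T', Finsupp.single (oflipCM c hc2 s T₀) (1 : ℤ) + ∑ u ∈ (T₀.1 ∩ T₁.1) \ T', Finsupp.single (oflipCM c hc2 u T₁) (1 : ℤ) -
      ((m : ℤ) - 1) • (Finsupp.single T₀ (1 : ℤ) + Finsupp.single T₁ 1) ∈ L)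
    (h2Y' : ∀ t ∈ (T₀.1 ∩ T₁.1) \ T', (2 : ℤ) • ((Finsupp.single (oflipCM c hc2 t T₀) (1 : ℤ) - Finsupp.single T₀ 1) -
      (Finsupp.single (oflipCM c hc2 t T₁) (1 : ℤ) - Finsupp.single T₁ 1)) ∈ L) :
    (2 : ℤ) • (-Finsupp.single T₁ (1 : ℤ) - Finsupp.single T₀ 1 -
      ∑ t ∈ T₀.1 ∩ T₁.1, (Finsupp.single (oflipCM c hc2 t T₀) (1 : ℤ) - Finsupp.single T₀ 1)) ∈ L := by
  set e₀ : CMF G c →₀ ℤ := Finsupp.single T₀ 1 with he₀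
  set e₁ : CMF G c →₀ ℤ := Finsupp.single T₁ 1 with he₁
  set f : G → (CMF G c →₀ ℤ) := fun s => Finsupp.single (oflipCM c hc2 s T₀) 1 with hf
  set g : G → (CMF G c →₀ ℤ) := fun s => Finsupp.single (oflipCM c hc2 s T₁) 1 with hg
  have hcardD : (((T₀.1 ∩ T₁.1) \ T').card : ℤ) = m := by
    have h : ((T₀.1 ∩ T₁.1) \ T').card = m := by rw [card_sdiff_of_subset hT', hHc, hT'm]; omega
    exact_mod_cast h
  have hsumf : ∑ t ∈ T₀.1 ∩ T₁.1, f t = ∑ t ∈ (T₀.1 ∩ T₁.1) \ T', f t + ∑ t ∈ T', f t := (Finset.sum_sdiff hT').symm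
  have key : (2 : ℤ) • (-e₁ - e₀ - ∑ t ∈ T₀.1 ∩ T₁.1, (f t - e₀)) =
      -((2 : ℤ) • (∑ s ∈ T', f s + ∑ u ∈ (T₀.1 ∩ T₁.1) \ T', g u - ((m : ℤ) - 1) • (e₀ + e₁))) -
        ∑ t ∈ (T₀.1 ∩ T₁.1) \ T', (2 : ℤ) • ((f t - e₀) - (g t - e₁)) := by
    rw [Finset.sum_sub_distrib, Finset.sum_const, hHc, hsumf]
    rw [show ∑ t ∈ (T₀.1 ∩ T₁.1) \ T', (2 : ℤ) • ((f t - e₀) - (g t - e₁)) =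
        (2 : ℤ) • (∑ t ∈ (T₀.1 ∩ T₁.1) \ T', f t) - (2 : ℤ) • (∑ t ∈ (T₀.1 ∩ T₁.1) \ T', g t) -
          (2 * (m : ℤ)) • e₀ + (2 * (m : ℤ)) • e₁ from by
      rw [← Finset.smul_sum, Finset.sum_sub_distrib, Finset.sum_sub_distrib, Finset.sum_sub_distrib, Finset.sum_const,
        Finset.sum_const, smul_sub, smul_sub, smul_sub]
      rw [← Nat.cast_smul_eq_nsmul ℤ, ← Nat.cast_smul_eq_nsmul ℤ, hcardD, smul_smul, smul_smul]
      module]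
    rw [← Nat.cast_smul_eq_nsmul ℤ (2 * m)]
    push_cast
    module
  have h := Submodule.sub_mem _ (Submodule.neg_mem _ (Submodule.smul_mem _ (2 : ℤ) hRc)) (Submodule.sum_mem _ fun t ht => h2Y' t ht)
  rw [← key] at h
  exact h

/-- **`2ρ(T̄₀) ∈ L`**: `ρ(T̄₀) = pair T₀ + ρ(T₁) + σ₁` since `T₀ = 𝓗 ⊔ 𝓗ᶜ`. [folklore] -/
theorem two_smul_defect_compl_T₀_mem (hcen : ∀ x : G, x * c = c * x) (L : Submodule ℤ (CMF G c →₀ ℤ)) (hP : ∀ Ψ : CMF G c, pair c Ψ ∈ L)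
    (hρ₁ : (2 : ℤ) • (Finsupp.single T₁ 1 - thetaG c hc2 T₀ (typeSum G c (Finsupp.single T₁ 1))) ∈ L)
    (hσ : (2 : ℤ) • (-Finsupp.single T₁ (1 : ℤ) - Finsupp.single T₀ 1 -
      ∑ t ∈ T₀.1 ∩ T₁.1, (Finsupp.single (oflipCM c hc2 t T₀) (1 : ℤ) - Finsupp.single T₀ 1)) ∈ L) :
    (2 : ℤ) • (Finsupp.single (rt c c T₀) 1 - thetaG c hc2 T₀ (typeSum G c (Finsupp.single (rt c c T₀) 1))) ∈ L := by
  have hT : T₀.1 \ (rt c c T₀).1 = T₀.1 := by rw [dev_compl c hcen, Finset.sdiff_self, Finset.sdiff_empty]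
  have hsplit : ∑ t ∈ T₀.1, (Finsupp.single (oflipCM c hc2 t T₀) (1 : ℤ) - Finsupp.single T₀ 1) =
      ∑ t ∈ T₀.1 \ T₁.1, (Finsupp.single (oflipCM c hc2 t T₀) (1 : ℤ) - Finsupp.single T₀ 1) +
        ∑ t ∈ T₀.1 ∩ T₁.1, (Finsupp.single (oflipCM c hc2 t T₀) (1 : ℤ) - Finsupp.single T₀ 1) := by
    rw [← Finset.sum_union (disjoint_sdiff_inter T₀.1 T₁.1), sdiff_union_inter]
  have hc0 : Finsupp.single (rt c c T₀) (1 : ℤ) = pair c T₀ - Finsupp.single T₀ 1 := by rw [pair, add_sub_cancel_left]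
  have key : (2 : ℤ) • (Finsupp.single (rt c c T₀) 1 - thetaG c hc2 T₀ (typeSum G c (Finsupp.single (rt c c T₀) 1))) =
      (2 : ℤ) • pair c T₀ + (2 : ℤ) • (Finsupp.single T₁ 1 - thetaG c hc2 T₀ (typeSum G c (Finsupp.single T₁ 1))) +
        (2 : ℤ) • (-Finsupp.single T₁ (1 : ℤ) - Finsupp.single T₀ 1 -
          ∑ t ∈ T₀.1 ∩ T₁.1, (Finsupp.single (oflipCM c hc2 t T₀) (1 : ℤ) - Finsupp.single T₀ 1)) := by
    rw [thetaG_typeSum_single c T₀ hc2, thetaG_typeSum_single c T₀ hc2, hT, hsplit, hc0]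
    module
  rw [key]
  exact Submodule.add_mem _ (Submodule.add_mem _ (Submodule.smul_mem _ _ (hP T₀)) hρ₁) hσ

/-- **`2ρ(T₁^{(s)}) ∈ L` for `s ∈ 𝓗`**: `ρ(T₁^{(s)}) = ρ(T₁) + Y_s`. [folklore] -/
theorem two_smul_defect_oflipCM_T₁_mem_of_mem_sdiff (L : Submodule ℤ (CMF G c →₀ ℤ)) {s : G} (hs : s ∈ T₀.1 \ T₁.1)
    (hρ₁ : (2 : ℤ) • (Finsupp.single T₁ 1 - thetaG c hc2 T₀ (typeSum G c (Finsupp.single T₁ 1))) ∈ L)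
    (h2Y : (2 : ℤ) • ((Finsupp.single (oflipCM c hc2 s T₀) (1 : ℤ) - Finsupp.single T₀ 1) +
      (Finsupp.single (oflipCM c hc2 s T₁) (1 : ℤ) - Finsupp.single T₁ 1)) ∈ L) :
    (2 : ℤ) • (Finsupp.single (oflipCM c hc2 s T₁) 1 - thetaG c hc2 T₀ (typeSum G c (Finsupp.single (oflipCM c hc2 s T₁) 1))) ∈ L := by
  rw [defect_oflipCM_of_not_mem c hc2 T₀ T₁ (mem_sdiff.mp hs).1 (mem_sdiff.mp hs).2, add_assoc, smul_add, add_comm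
    (Finsupp.single (oflipCM c hc2 s T₁) 1 - Finsupp.single T₁ 1)]
  exact Submodule.add_mem _ hρ₁ h2Y

/-- **`2ρ(T₁^{(s)}) ∈ L` for `s ∈ 𝓗ᶜ`**: `ρ(T₁^{(s)}) = ρ(T₁) − Y'_s`. [folklore] -/
theorem two_smul_defect_oflipCM_T₁_mem_of_mem_inter (L : Submodule ℤ (CMF G c →₀ ℤ)) {s : G} (hs : s ∈ T₀.1 ∩ T₁.1)
    (hρ₁ : (2 : ℤ) • (Finsupp.single T₁ 1 - thetaG c hc2 T₀ (typeSum G c (Finsupp.single T₁ 1))) ∈ L)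
    (h2Y' : (2 : ℤ) • ((Finsupp.single (oflipCM c hc2 s T₀) (1 : ℤ) - Finsupp.single T₀ 1) -
      (Finsupp.single (oflipCM c hc2 s T₁) (1 : ℤ) - Finsupp.single T₁ 1)) ∈ L) :
    (2 : ℤ) • (Finsupp.single (oflipCM c hc2 s T₁) 1 - thetaG c hc2 T₀ (typeSum G c (Finsupp.single (oflipCM c hc2 s T₁) 1))) ∈ L := by
  have e : Finsupp.single (oflipCM c hc2 s T₁) 1 - thetaG c hc2 T₀ (typeSum G c (Finsupp.single (oflipCM c hc2 s T₁) 1)) =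
      (Finsupp.single T₁ 1 - thetaG c hc2 T₀ (typeSum G c (Finsupp.single T₁ 1))) -
        ((Finsupp.single (oflipCM c hc2 s T₀) (1 : ℤ) - Finsupp.single T₀ 1) -
          (Finsupp.single (oflipCM c hc2 s T₁) (1 : ℤ) - Finsupp.single T₁ 1)) := by
    rw [defect_oflipCM_of_mem c hc2 T₀ T₁ (mem_inter.mp hs).1 (mem_inter.mp hs).2]
    abel
  rw [e, smul_sub]
  exact Submodule.sub_mem _ hρ₁ h2Y'

end Four

/-! ## §3 Residual closure of the four-type block -/

/-- **RESIDUAL CLOSURE OF THE FOUR-TYPE BLOCK.**  Central involution `c ≠ 1`, base types `T₀`, `T₁` with `|T₀ ∖ T₁| = |T₀ ∩ T₁| = 2m`; a lattice `L`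
containing all pairs, the doubled classes `2Y_s` (`s ∈ T₀ ∖ T₁`), `2Y'_s` (`s ∈ T₀ ∩ T₁`), one transversal relation `R(T)` (`T ⊆ T₀ ∖ T₁`, `|T| = m`) and one
`Rᶜ(T')` (`T' ⊆ T₀ ∩ T₁`, `|T'| = m`).  Then `2y ∈ L` for every Hodge vector `y` supported on `T₀`, `T₁`, their complements and the single flips of these
four types. [folklore] -/
theorem residual_closure_four (hc2 : c * c = 1) (hc1 : c ≠ 1) (hcen : ∀ x : G, x * c = c * x) (T₀ T₁ : CMF G c)
    (L : Submodule ℤ (CMF G c →₀ ℤ)) (hP : ∀ Ψ : CMF G c, pair c Ψ ∈ L) (m : ℕ)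
    (hH : (T₀.1 \ T₁.1).card = 2 * m) (hHc : (T₀.1 ∩ T₁.1).card = 2 * m)
    (h2Y : ∀ s ∈ T₀.1 \ T₁.1, (2 : ℤ) • ((Finsupp.single (oflipCM c hc2 s T₀) (1 : ℤ) - Finsupp.single T₀ 1) +
      (Finsupp.single (oflipCM c hc2 s T₁) (1 : ℤ) - Finsupp.single T₁ 1)) ∈ L)
    (h2Y' : ∀ s ∈ T₀.1 ∩ T₁.1, (2 : ℤ) • ((Finsupp.single (oflipCM c hc2 s T₀) (1 : ℤ) - Finsupp.single T₀ 1) -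
      (Finsupp.single (oflipCM c hc2 s T₁) (1 : ℤ) - Finsupp.single T₁ 1)) ∈ L)
    (hR : ∃ T : Finset G, T ⊆ T₀.1 \ T₁.1 ∧ T.card = m ∧
      ∑ s ∈ T, Finsupp.single (oflipCM c hc2 s T₀) (1 : ℤ) - ∑ u ∈ (T₀.1 \ T₁.1) \ T, Finsupp.single (oflipCM c hc2 u T₁) (1 : ℤ) -
        ((m : ℤ) - 1) • (Finsupp.single T₀ (1 : ℤ) - Finsupp.single T₁ 1) ∈ L)
    (hRc : ∃ T' : Finset G, T' ⊆ T₀.1 ∩ T₁.1 ∧ T'.card = m ∧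
      ∑ s ∈ T', Finsupp.single (oflipCM c hc2 s T₀) (1 : ℤ) + ∑ u ∈ (T₀.1 ∩ T₁.1) \ T', Finsupp.single (oflipCM c hc2 u T₁) (1 : ℤ) -
        ((m : ℤ) - 1) • (Finsupp.single T₀ (1 : ℤ) + Finsupp.single T₁ 1) ∈ L) :
    ∀ y ∈ hodgeSpan c hc2, (∀ Ψ ∈ y.support, Ψ = T₀ ∨ Ψ = T₁ ∨ Ψ = rt c c T₀ ∨ Ψ = rt c c T₁ ∨
      ∃ s : G, Ψ = oflipCM c hc2 s T₀ ∨ Ψ = oflipCM c hc2 s T₁ ∨ Ψ = oflipCM c hc2 s (rt c c T₀) ∨ Ψ = oflipCM c hc2 s (rt c c T₁)) →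
      ((2 : ℤ) ^ 1) • y ∈ L := by
  classical
  obtain ⟨T, hT, hTm, hRT⟩ := hR
  obtain ⟨T', hT', hT'm, hRT'⟩ := hRc
  -- the defects of the four base types
  have hρ₁ := two_smul_defect_T₁_mem c hc2 T₀ T₁ L m hH hT hTm hRT fun t ht => h2Y t (mem_sdiff.mp ht).1
  have hσ := two_smul_sigma_mem c hc2 T₀ T₁ L m hHc hT' hT'm hRT' fun t ht => h2Y' t (mem_sdiff.mp ht).1
  have hρ₀c := two_smul_defect_compl_T₀_mem c hc2 T₀ T₁ hcen L hP hρ₁ hσ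
  -- defect of any flip of `T₁` at a place `s` (normalised into `T₀`)
  have hflip₁ : ∀ s : G, (2 : ℤ) • (Finsupp.single (oflipCM c hc2 s T₁) 1 -
      thetaG c hc2 T₀ (typeSum G c (Finsupp.single (oflipCM c hc2 s T₁) 1))) ∈ L := by
    -- normalise the place representative into `T₀`
    suffices h : ∀ s ∈ T₀.1, (2 : ℤ) • (Finsupp.single (oflipCM c hc2 s T₁) 1 -
        thetaG c hc2 T₀ (typeSum G c (Finsupp.single (oflipCM c hc2 s T₁) 1))) ∈ L by
      intro s
      by_cases hs : s ∈ T₀.1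
      · exact h s hs
      · have hcs : c * s ∈ T₀.1 := by by_contra h'; exact hs ((T₀.2 s).mpr h')
        have e : oflipCM c hc2 s T₁ = oflipCM c hc2 (c * s) T₁ := (oflipCM_cmul c hc2 s T₁).symm
        rw [e]; exact h (c * s) hcs
    intro s hs
    by_cases hs1 : s ∈ T₁.1
    · exact two_smul_defect_oflipCM_T₁_mem_of_mem_inter c hc2 T₀ T₁ L (mem_inter.mpr ⟨hs, hs1⟩) hρ₁ (h2Y' s (mem_inter.mpr ⟨hs, hs1⟩))
    · exact two_smul_defect_oflipCM_T₁_mem_of_mem_sdiff c hc2 T₀ T₁ L (mem_sdiff.mpr ⟨hs, hs1⟩) hρ₁ (h2Y s (mem_sdiff.mpr ⟨hs, hs1⟩))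
  have hflip₀ : ∀ s : G, (2 : ℤ) • (Finsupp.single (oflipCM c hc2 s T₀) 1 -
      thetaG c hc2 T₀ (typeSum G c (Finsupp.single (oflipCM c hc2 s T₀) 1))) ∈ L := by
    intro s
    by_cases hs : s ∈ T₀.1
    · rw [defect_oflipCM_base c hc2 T₀ hs, smul_zero]; exact Submodule.zero_mem _
    · have hcs : c * s ∈ T₀.1 := by by_contra h'; exact hs ((T₀.2 s).mpr h')
      rw [← oflipCM_cmul c hc2 s T₀, defect_oflipCM_base c hc2 T₀ hcs, smul_zero]; exact Submodule.zero_mem _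
  -- complements
  have hcompl : ∀ X : CMF G c, (2 : ℤ) • (Finsupp.single X 1 - thetaG c hc2 T₀ (typeSum G c (Finsupp.single X 1))) ∈ L →
      (2 : ℤ) • (Finsupp.single (rt c c X) 1 - thetaG c hc2 T₀ (typeSum G c (Finsupp.single (rt c c X) 1))) ∈ L := by
    intro X hX
    rw [defect_compl c hc2 hcen T₀ X, smul_add, smul_sub, smul_sub]
    exact Submodule.add_mem _ (Submodule.sub_mem _ (Submodule.sub_mem _ (Submodule.smul_mem _ _ (hP X))
      (Submodule.smul_mem _ _ (hP T₀))) hX) hρ₀c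
  -- assemble by defect closure
  refine two_pow_smul_mem_of_defects c hc2 hc1 hcen T₀ L hP
    (fun Ψ => Ψ = T₀ ∨ Ψ = T₁ ∨ Ψ = rt c c T₀ ∨ Ψ = rt c c T₁ ∨
      ∃ s : G, Ψ = oflipCM c hc2 s T₀ ∨ Ψ = oflipCM c hc2 s T₁ ∨ Ψ = oflipCM c hc2 s (rt c c T₀) ∨ Ψ = oflipCM c hc2 s (rt c c T₁))
    (Or.inl rfl) (Or.inr (Or.inr (Or.inl rfl))) 1 fun X hX => ?_
  rw [pow_one]
  rcases hX with rfl | rfl | rfl | rfl | ⟨s, rfl | rfl | rfl | rfl⟩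
  · rw [defect_base, smul_zero]; exact Submodule.zero_mem _
  · exact hρ₁
  · exact hρ₀c
  · exact hcompl T₁ hρ₁
  · exact hflip₀ s
  · exact hflip₁ s
  · rw [oflipCM_rt_self c hc2 hcen]; exact hcompl _ (hflip₀ s)
  · rw [oflipCM_rt_self c hc2 hcen]; exact hcompl _ (hflip₁ s)

end

end Summit.HodgeConjecture.CorCM.Census.CentralSquares
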